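import Mathlib
import Summits.NavierStokesRegularity.NavierStokesRegularity.Theorems.EulerZoomLiouvillePowerGaugeEulerLiouvilleAllRhoStrata
import Summits.NavierStokesRegularity.NavierStokesRegularity.Theorems.EulerZoomLiouvillePowerGaugeEulerLiouvilleEnergyVanishingTools
import Summits.NavierStokesRegularity.NavierStokesRegularity.Theorems.EulerZoomLiouvillePowerGaugeEulerLiouvillePastFastClock
import HarnessLib

/-!
# FINITE-ENERGY log-time breathers are trivial; at the ENDPOINT `ρ = ½` EVERY log-time breather is trivial
# (crux `EulerZoomLiouville.PowerGaugeEulerLiouville` = stmt-NavierStokesRegularity-19832; line `logtime-breathers` of ns-idea-11, a bite out of the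
# residue T3 `stub_wildBreatherRest` — member-level fillers, WEAK class, NO regularity, NO tameness)

Route `EulerZoomLiouville` (NavierStokesRegularity); width seat ns-ezl-w4 g2.  A LOG-TIME BREATHER contracting into the past — rate `c > 0`,
profile `V` — is a member with `u(τ, y) = e^{cτ} V(e^{−cτ} y)` for `τ < T₁` (`T₁ ≤ 0`; arbitrary on `[T₁, 0)`).  The tree kills `c < 0`
(T2a, any profile: `PastShape.ae_eq_zero_of_gauge_of_pastExpandingBreather`) and, for `c > 0`, the TAME profiles (T2b,
`LogtimeBreather.ae_eq_zero_of_gauge_of_tameBreather`) and the bounded steep-vorticity profiles (`…LogtimeBreatherSteepVorticity`), both by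
Lagrangian transport along the inward characteristics of `V − cz`.  Here is the ENERGY lever, which needs no regularity at all:

> the total energy of a breather slice is `∫_{ℝ³} |u(τ)|² = e^{5cτ} ∫_{ℝ³} |V|²` (amplitude `e^{2cτ}`, Jacobian `e^{3cτ}`);
> for `c > 0` and `V ∈ L²` it tends to ZERO as `τ → −∞`, so the past is energy-quiescent and the crux's filled stratum
> `ae_eq_zero_of_gauge_of_energyVanishing_allRho` (`stub_quiescentPast`) makes the member vanish on the whole slab (any `ρ ≥ 0`).

(Equivalently: a contracting breather GAINS energy, `E(τ) = e^{5cτ}‖V‖²₂` increasing, against the class's global energy inequality.)  At the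
ENDPOINT `ρ = ½` the hypothesis `V ∈ L²` is AUTOMATIC: the `A`-gauge bounds every slice energy by `c` (`lintegral_enorm_sq_le_of_gauge_half`), and
one slice `τ < T₁` gives `‖V‖²₂ ≤ e^{−5cτ} c < ∞`.  Together with T2a, EVERY log-time breather member (`c ≠ 0`, any profile, weak class) is trivial
at `ρ = ½`: the breather chapter of the line CLOSES at the endpoint, and for `ρ < ½` the wild residue T3 shrinks to INFINITE-ENERGY wild profiles
(`∫_{B_R}|V|²` growing like `R^{1−2ρ}`, the extremal rate the `A`-gauge allows).

* `LogtimeBreather.lintegral_enorm_sq_breatherSlice_univ` — the whole-space slice identity `∫⁻‖e^{cτ}V(e^{−cτ}y)‖ₑ² dy = e^{5cτ} ∫⁻‖V‖ₑ²`;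
* `LogtimeBreather.ae_eq_zero_of_gauge_of_finiteEnergyBreather` — MEMBER LEVEL, crux hypotheses verbatim (any `ρ ≥ 0`) + `c > 0` + the breather
  identity for `τ < T₁ ≤ 0` + `∫⁻ ‖V‖ₑ² < ∞` ⇒ `u = 0` a.e. on `(−∞,0) × ℝ³`;
* `LogtimeBreather.lintegral_enorm_sq_profile_lt_top_of_gauge_half` — `ρ = ½`: the `A`-gauge alone gives `∫⁻ ‖V‖ₑ² < ∞` for a contracting breather;
* `LogtimeBreather.ae_eq_zero_of_gauge_half_of_contractingBreather` / `…_of_gauge_half_of_breather` — ENDPOINT `ρ = ½`: every breather with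
  `c > 0` / with `c ≠ 0` (any profile) is trivial.

Suggested wiring (LEAD's call): a fourth disjunct of `IsFadingTamePast` / `IsShapeFastClock` «finite-energy contracting breather on a past sub-slab»,
and at `ρ = ½` the clause `0 < c` of `IsTameClassicalShapePreserving`'s breather tameness becomes idle.

WHAT THIS IS NOT: not NS, not E — one more stratum of the crux CLASS 19832 on the MODEL lattice, `--supports` stmt-19832; the infinite-energy wild
breathers (`ρ < ½`), the window power clocks and the shapeless members stay OPEN. [folklore; line card `Cruxes/PowerGaugeEulerLiouville/Lines/logtime-breathers.md` T3]
-/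

noncomputable section

-- flat `Theorems/<Route><Decl>…` files of one crux share the namespace of the crux (tree convention: `Summit.<S>.<S>.…`)
set_option linter.dupNamespace false

open MeasureTheory Set Filter Topology Metric Function TopologicalSpace Module
open scoped ENNReal NNReal

namespace Summit.NavierStokesRegularity.NavierStokesRegularity.Theorems.PowerGaugeEulerLiouville

open Literature.Analysis Literature.Analysis.FunctionSpaces Literature.Analysis.FluidPDE

namespace LogtimeBreather

variable {u : ℝ → EuclideanSpace ℝ (Fin 3) → EuclideanSpace ℝ (Fin 3)} {p : ℝ → EuclideanSpace ℝ (Fin 3) → ℝ}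
  {H : ℝ → EuclideanSpace ℝ (Fin 3) → EuclideanSpace ℝ (Fin 3) →L[ℝ] EuclideanSpace ℝ (Fin 3)} {c : ℝ≥0}

/-! ### The whole-space slice identity -/

/-- Change of variables `x = t • y` (`t > 0`) in a Lebesgue integral over `ℝ³`: `∫⁻ G(t • y) dy = t⁻³ ∫⁻ G` (Mathlib `Measure.map_addHaar_smul`;
lower integrals, no measurability). [folklore] -/
theorem lintegral_comp_smul_univ (G : EuclideanSpace ℝ (Fin 3) → ℝ≥0∞) {t : ℝ} (ht : 0 < t) :
    ∫⁻ y, G (t • y) = ENNReal.ofReal ((t ^ 3)⁻¹) * ∫⁻ x, G x := by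
  have ht0 : t ≠ 0 := ht.ne'
  have hme : MeasurableEmbedding (fun x : EuclideanSpace ℝ (Fin 3) => t • x) :=
    (Homeomorph.smul (isUnit_iff_ne_zero.2 ht0).unit).toMeasurableEquiv.measurableEmbedding
  calc ∫⁻ y, G (t • y) = ∫⁻ y, G ((fun x : EuclideanSpace ℝ (Fin 3) => t • x) y) := rfl
    _ = ∫⁻ x, G x ∂(Measure.map (fun x : EuclideanSpace ℝ (Fin 3) => t • x) volume) := (hme.lintegral_map G).symm
    _ = ENNReal.ofReal ((t ^ 3)⁻¹) * ∫⁻ x, G x := by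
        rw [Measure.map_addHaar_smul volume ht0, lintegral_smul_measure, finrank_euclideanSpace_fin,
          abs_of_nonneg (by positivity), smul_eq_mul]

/-- **Total energy of a breather slice.**  `∫_{ℝ³} ‖e^{cτ} V(e^{−cτ} y)‖² dy = e^{5cτ} ∫_{ℝ³} ‖V‖²` (amplitude `e^{2cτ}`, Jacobian `e^{3cτ}`), as lower
integrals (no measurability; both sides may be `∞`). [folklore] -/
theorem lintegral_enorm_sq_breatherSlice_univ (c τ : ℝ)
    (V : EuclideanSpace ℝ (Fin 3) → EuclideanSpace ℝ (Fin 3)) :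
    ∫⁻ y, ‖Real.exp (c * τ) • V (Real.exp (-(c * τ)) • y)‖ₑ ^ 2 =
      ENNReal.ofReal (Real.exp (5 * (c * τ))) * ∫⁻ x, ‖V x‖ₑ ^ 2 := by
  -- adapted from `lintegral_ball_enorm_sq_breatherSlice` (…LogtimeBreatherExpanding)
  have hm : 0 < Real.exp (c * τ) := Real.exp_pos _
  have hd : 0 < Real.exp (-(c * τ)) := Real.exp_pos _
  have h1 : ∀ y : EuclideanSpace ℝ (Fin 3), ‖Real.exp (c * τ) • V (Real.exp (-(c * τ)) • y)‖ₑ ^ 2 =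
      ENNReal.ofReal (Real.exp (c * τ) ^ 2) * ‖V (Real.exp (-(c * τ)) • y)‖ₑ ^ 2 := by
    intro y
    rw [enorm_smul, mul_pow, Real.enorm_eq_ofReal hm.le, ← ENNReal.ofReal_pow hm.le]
  simp_rw [h1]
  rw [lintegral_const_mul' _ _ ENNReal.ofReal_ne_top,
    lintegral_comp_smul_univ (fun x => ‖V x‖ₑ ^ 2) hd, ← mul_assoc, ← ENNReal.ofReal_mul (by positivity)]
  congr 2
  rw [← Real.exp_nat_mul, ← Real.exp_nat_mul, ← Real.exp_neg, ← Real.exp_add]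
  congr 1
  push_cast
  ring

/-! ### Finite-energy contracting breathers (any `ρ ≥ 0`) -/

/-- **FINITE-ENERGY LOG-TIME BREATHERS ARE TRIVIAL** (crux hypotheses verbatim — suitable weak Euler pair on the slab, weak gradient, the three power
gauges —, any `ρ ≥ 0`; no regularity, no tameness): if `u(τ, y) = e^{cτ} V(e^{−cτ} y)` for all `τ < T₁` (any `T₁`; only `τ < 0` matters) with `c > 0` and
`∫_{ℝ³}‖V‖² < ∞`, then `u = 0` a.e. on `(−∞,0) × ℝ³`.  The slice energy `e^{5cτ}‖V‖²₂` tends to `0` as `τ → −∞`, so the past is energy-quiescent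
and `ae_eq_zero_of_gauge_of_energyVanishing_allRho` concludes. [folklore] -/
theorem ae_eq_zero_of_gauge_of_finiteEnergyBreather {ρ : ℝ} (hρ : 0 ≤ ρ)
    (hsw : IsSuitableWeakSolutionOn (slab (EuclideanSpace ℝ (Fin 3)) (Iio 0) isOpen_Iio) 0 0 u p)
    (hH : HasWeakSpatialGradientOn (slab (EuclideanSpace ℝ (Fin 3)) (Iio 0) isOpen_Iio) u H)
    (hgauge : ∀ a : ℝ, 0 < a →
      ENNReal.ofReal (a ^ (2 * ρ)) * cknA a (0 : ℝ × EuclideanSpace ℝ (Fin 3)) u +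
          ENNReal.ofReal (a ^ ρ) * cknE a (0 : ℝ × EuclideanSpace ℝ (Fin 3)) H +
        ENNReal.ofReal (a ^ (2 * ρ)) * cknD a (0 : ℝ × EuclideanSpace ℝ (Fin 3)) p ≤ (c : ℝ≥0∞))
    {T₁ : ℝ} {c' : ℝ} (hc' : 0 < c') {V : EuclideanSpace ℝ (Fin 3) → EuclideanSpace ℝ (Fin 3)}
    (hbr : ∀ τ : ℝ, τ < T₁ → ∀ y : EuclideanSpace ℝ (Fin 3),
      u τ y = Real.exp (c' * τ) • V (Real.exp (-(c' * τ)) • y))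
    (hV : ∫⁻ x, ‖V x‖ₑ ^ 2 < ∞) :
    uncurry u =ᵐ[volume.restrict (Iio (0 : ℝ) ×ˢ (univ : Set (EuclideanSpace ℝ (Fin 3))))] 0 := by
  set J : ℝ≥0∞ := ∫⁻ x, ‖V x‖ₑ ^ 2 with hJ
  have hJr : J = ENNReal.ofReal J.toReal := (ENNReal.ofReal_toReal hV.ne).symm
  -- ### the slice energies `E(s) = e^{5c's} J`
  have hslice : ∀ s : ℝ, s < T₁ → ∫⁻ x, ‖u s x‖ₑ ^ 2 = ENNReal.ofReal (Real.exp (5 * (c' * s))) * J := by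
    intro s hs
    have hfun : (fun x => ‖u s x‖ₑ ^ 2) =
        fun x => ‖Real.exp (c' * s) • V (Real.exp (-(c' * s)) • x)‖ₑ ^ 2 := by
      funext x; rw [hbr s hs x]
    rw [hfun, lintegral_enorm_sq_breatherSlice_univ]
  -- ### the energy-quiescent past
  refine ae_eq_zero_of_gauge_of_energyVanishing_allRho hρ hsw hH hgauge fun ε hε N => ?_
  -- `e^{5c's} J.toReal → 0` as `s → −∞`
  have htend : Tendsto (fun s : ℝ => Real.exp (5 * (c' * s)) * J.toReal) atBot (𝓝 (0 * J.toReal)) := by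
    refine Tendsto.mul ?_ tendsto_const_nhds
    have h5 : Tendsto (fun s : ℝ => 5 * (c' * s)) atBot atBot :=
      (tendsto_id.const_mul_atBot hc').const_mul_atBot (by norm_num)
    exact Real.tendsto_exp_atBot.comp h5
  rw [zero_mul] at htend
  obtain ⟨s₀, hs₀⟩ := ((htend.eventually (Iio_mem_nhds hε)).and (eventually_lt_atBot (min (-N) T₁))).exists_forall_of_atBot
  -- every `s ≤ s₀` qualifies
  have hsub : Iic s₀ ⊆ {s : ℝ | s < -N ∧ ∫⁻ x, ‖u s x‖ₑ ^ 2 ≤ ENNReal.ofReal ε} := by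
    intro s hs
    obtain ⟨hlt, hsm⟩ := hs₀ s hs
    rw [lt_min_iff] at hsm
    refine ⟨hsm.1, ?_⟩
    rw [hslice s hsm.2, hJr, ← ENNReal.ofReal_mul (Real.exp_pos _).le]
    exact ENNReal.ofReal_le_ofReal hlt.le
  have hinf : volume (Iic s₀) = (⊤ : ℝ≥0∞) := Real.volume_Iic
  intro h0
  have := measure_mono_null hsub h0
  rw [hinf] at this
  exact ENNReal.top_ne_zero this

/-! ### The endpoint `ρ = ½`: every breather is trivial -/

/-- **At `ρ = ½` the profile of a contracting breather has finite energy** (the `A`-gauge alone): every slice of an endpoint member has energy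
`≤ c` (`lintegral_enorm_sq_le_of_gauge_half`), and the slice `τ = T₁ − 1` of the breather gives `‖V‖²₂ = e^{−5cτ} ∫|u(τ)|² < ∞`. [folklore] -/
theorem lintegral_enorm_sq_profile_lt_top_of_gauge_half
    (hA : ∀ a : ℝ, 0 < a →
      ENNReal.ofReal (a ^ (2 * (1 / 2 : ℝ))) * cknA a (0 : ℝ × EuclideanSpace ℝ (Fin 3)) u ≤ (c : ℝ≥0∞))
    {T₁ : ℝ} (hT₁ : T₁ ≤ 0) {c' : ℝ} {V : EuclideanSpace ℝ (Fin 3) → EuclideanSpace ℝ (Fin 3)}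
    (hbr : ∀ τ : ℝ, τ < T₁ → ∀ y : EuclideanSpace ℝ (Fin 3),
      u τ y = Real.exp (c' * τ) • V (Real.exp (-(c' * τ)) • y)) :
    ∫⁻ x, ‖V x‖ₑ ^ 2 < ∞ := by
  set τ : ℝ := T₁ - 1 with hτ
  have hτT : τ < T₁ := by rw [hτ]; linarith
  have hτ0 : τ < 0 := by linarith
  have hE : ∫⁻ x, ‖u τ x‖ₑ ^ 2 ≤ (c : ℝ≥0∞) := lintegral_enorm_sq_le_of_gauge_half hA hτ0
  have hfun : (fun x => ‖u τ x‖ₑ ^ 2) =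
      fun x => ‖Real.exp (c' * τ) • V (Real.exp (-(c' * τ)) • x)‖ₑ ^ 2 := by
    funext x; rw [hbr τ hτT x]
  rw [hfun, lintegral_enorm_sq_breatherSlice_univ] at hE
  -- divide by `e^{5c'τ} > 0`
  have hpos : ENNReal.ofReal (Real.exp (5 * (c' * τ))) ≠ 0 := by
    rw [ENNReal.ofReal_ne_zero_iff]; exact Real.exp_pos _
  rw [lt_top_iff_ne_top]
  intro hJ
  rw [hJ, ENNReal.mul_top hpos] at hE
  exact ENNReal.coe_ne_top (top_le_iff.1 hE)

/-- **ENDPOINT `ρ = ½`: CONTRACTING LOG-TIME BREATHERS ARE TRIVIAL, ANY PROFILE** (crux hypotheses verbatim at `ρ = ½`; weak class, no regularity):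
`u(τ, y) = e^{cτ} V(e^{−cτ} y)` for `τ < T₁ ≤ 0` with `c > 0` ⇒ `u = 0` a.e.  (`V ∈ L²` by `lintegral_enorm_sq_profile_lt_top_of_gauge_half`, then
`ae_eq_zero_of_gauge_of_finiteEnergyBreather`.) [folklore] -/
theorem ae_eq_zero_of_gauge_half_of_contractingBreather
    (hsw : IsSuitableWeakSolutionOn (slab (EuclideanSpace ℝ (Fin 3)) (Iio 0) isOpen_Iio) 0 0 u p)
    (hH : HasWeakSpatialGradientOn (slab (EuclideanSpace ℝ (Fin 3)) (Iio 0) isOpen_Iio) u H)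
    (hgauge : ∀ a : ℝ, 0 < a →
      ENNReal.ofReal (a ^ (2 * (1 / 2 : ℝ))) * cknA a (0 : ℝ × EuclideanSpace ℝ (Fin 3)) u +
          ENNReal.ofReal (a ^ (1 / 2 : ℝ)) * cknE a (0 : ℝ × EuclideanSpace ℝ (Fin 3)) H +
        ENNReal.ofReal (a ^ (2 * (1 / 2 : ℝ))) * cknD a (0 : ℝ × EuclideanSpace ℝ (Fin 3)) p ≤ (c : ℝ≥0∞))
    {T₁ : ℝ} (hT₁ : T₁ ≤ 0) {c' : ℝ} (hc' : 0 < c') {V : EuclideanSpace ℝ (Fin 3) → EuclideanSpace ℝ (Fin 3)}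
    (hbr : ∀ τ : ℝ, τ < T₁ → ∀ y : EuclideanSpace ℝ (Fin 3),
      u τ y = Real.exp (c' * τ) • V (Real.exp (-(c' * τ)) • y)) :
    uncurry u =ᵐ[volume.restrict (Iio (0 : ℝ) ×ˢ (univ : Set (EuclideanSpace ℝ (Fin 3))))] 0 :=
  have hA : ∀ a : ℝ, 0 < a → ENNReal.ofReal (a ^ (2 * (1 / 2 : ℝ))) *
      cknA a (0 : ℝ × EuclideanSpace ℝ (Fin 3)) u ≤ (c : ℝ≥0∞) :=
    fun a ha => le_trans (le_trans le_self_add le_self_add) (hgauge a ha)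
  ae_eq_zero_of_gauge_of_finiteEnergyBreather (ρ := 1 / 2) (by norm_num) hsw hH hgauge hc' hbr
    (lintegral_enorm_sq_profile_lt_top_of_gauge_half hA hT₁ hbr)

/-- **ENDPOINT `ρ = ½`: EVERY LOG-TIME BREATHER IS TRIVIAL** (crux hypotheses verbatim at `ρ = ½`; weak class, no regularity, any rate `c ≠ 0`, any
profile): `u(τ, y) = e^{cτ} V(e^{−cτ} y)` for `τ < T₁ ≤ 0` ⇒ `u = 0` a.e.  (`c < 0`: T2a `PastShape.ae_eq_zero_of_gauge_of_pastExpandingBreather`;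
`c > 0`: `ae_eq_zero_of_gauge_half_of_contractingBreather`.)  The breather chapter of line `logtime-breathers` closes at the endpoint. [folklore] -/
theorem ae_eq_zero_of_gauge_half_of_breather
    (hsw : IsSuitableWeakSolutionOn (slab (EuclideanSpace ℝ (Fin 3)) (Iio 0) isOpen_Iio) 0 0 u p)
    (hH : HasWeakSpatialGradientOn (slab (EuclideanSpace ℝ (Fin 3)) (Iio 0) isOpen_Iio) u H)
    (hgauge : ∀ a : ℝ, 0 < a →
      ENNReal.ofReal (a ^ (2 * (1 / 2 : ℝ))) * cknA a (0 : ℝ × EuclideanSpace ℝ (Fin 3)) u +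
          ENNReal.ofReal (a ^ (1 / 2 : ℝ)) * cknE a (0 : ℝ × EuclideanSpace ℝ (Fin 3)) H +
        ENNReal.ofReal (a ^ (2 * (1 / 2 : ℝ))) * cknD a (0 : ℝ × EuclideanSpace ℝ (Fin 3)) p ≤ (c : ℝ≥0∞))
    {T₁ : ℝ} (hT₁ : T₁ ≤ 0) {c' : ℝ} (hc' : c' ≠ 0) {V : EuclideanSpace ℝ (Fin 3) → EuclideanSpace ℝ (Fin 3)}
    (hbr : ∀ τ : ℝ, τ < T₁ → ∀ y : EuclideanSpace ℝ (Fin 3),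
      u τ y = Real.exp (c' * τ) • V (Real.exp (-(c' * τ)) • y)) :
    uncurry u =ᵐ[volume.restrict (Iio (0 : ℝ) ×ˢ (univ : Set (EuclideanSpace ℝ (Fin 3))))] 0 := by
  rcases lt_or_gt_of_ne hc' with hneg | hpos
  · exact PastShape.ae_eq_zero_of_gauge_of_pastExpandingBreather (ρ := 1 / 2) (by norm_num) le_rfl hsw hH hgauge hT₁ hneg hbr
  · exact ae_eq_zero_of_gauge_half_of_contractingBreather hsw hH hgauge hT₁ hpos hbr

end LogtimeBreather

end Summit.NavierStokesRegularity.NavierStokesRegularity.Theorems.PowerGaugeEulerLiouville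

end
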